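import Summits.Ventures.PercRepro.C026BallFlip

/-!
# mine-3's Lemma 28.1: the sources are counted by the valid radii of the targets (p5, gen 15)

mine-3 (`proofs/MINE3-MONOTONICITY.md` §28, INBOX 16:34Z): `#N² = Σ_{T ∈ ac|b} v_a(T)`, where `v_a(T)` is the
number of valid `a`-radii of `T` — so `(2×)` reads «extra decodings ≤ undecodable targets». The identity is a
bijection: a source `S` at distance `r + 1` from `D` goes to the pair `(Z_r(S), r)`; a valid pair `(τ, r)` comes
back as the `r`-decoding of `τ`. This holds for EVERY source class `P` (`card_sources_eq_card_validPairs`); for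
`N²` every source reaches `D` (`exists_atDist_of_nTwo`), which gives the identity of the memo
(`card_nTwo_eq_sum_validRadii`).

* `ball_decode_eq` — the decoding keeps the balls of radius `≤ r`; **`ballFlip_decode`** — the ball map inverts
  the decoding on valid pairs; `AtDist.lt_card` — a radius is `< |V|` (the balls grow strictly up to the distance);
* **`card_sources_eq_card_validPairs`**, **`card_nTwo_eq_sum_validRadii`** (Lemma 28.1).
-/

namespace PercRepro

open Finset

namespace MultiGraph

section RadiusCount

variable {V E : Type*} {G : MultiGraph V E}

/-- The decoding keeps every edge at the ball. -/
theorem decode_apply_of_mem_ball {c a : V} {r : ℕ} {τ : Config E} {e : E}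
    (hB : e ∈ G.edgesAt (G.ball τ a r)) : G.decode c a r τ e = τ e := by
  simp [decode, hB]

/-- The decoding flips an edge at `D'` that is not at the ball. -/
theorem decode_apply_of_mem {c a : V} {r : ℕ} {τ : Config E} {e : E}
    (he : e ∈ G.edgesAt (G.decodeCluster c a r τ)) (hB : e ∉ G.edgesAt (G.ball τ a r)) :
    G.decode c a r τ e = !τ e := by
  simp [decode, he, hB]

/-- The decoding keeps every edge away from `D'`. -/
theorem decode_apply_of_notMem {c a : V} {r : ℕ} {τ : Config E} {e : E}
    (he : e ∉ G.edgesAt (G.decodeCluster c a r τ)) : G.decode c a r τ e = τ e := by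
  simp [decode, he]

/-- **The decoding keeps the balls of radius `≤ r`** (it touches no edge at the ball of radius `r`). -/
theorem ball_decode_eq {c a : V} {r : ℕ} {τ : Config E} {n : ℕ} (hn : n ≤ r) :
    G.ball (G.decode c a r τ) a n = G.ball τ a n := by
  refine ball_eq_of_agree ?_
  intro m hm e he
  rw [decode_apply_of_mem_ball (G.edgesAt_mono (ball_mono τ a (Nat.le_of_lt (Nat.lt_of_lt_of_le hm hn))) he)]

/-- **The ball map inverts the decoding on valid pairs**: `Z_r(decode_r τ) = τ` whenever the `r`-decoding of
`τ` is valid (its closed `c`-cluster is `D'`, and its ball of radius `r` is that of `τ`). -/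
theorem ballFlip_decode {P : Config E → Prop} {c a : V} {r : ℕ} {τ : Config E}
    (h : G.ValidDecoding P c a r τ) : G.ballFlip c a r (G.decode c a r τ) = τ := by
  funext e
  unfold ballFlip
  rw [h.2.1, ball_decode_eq le_rfl]
  by_cases hflip : e ∈ G.edgesAt (G.decodeCluster c a r τ) ∧ e ∉ G.edgesAt (G.ball τ a r)
  · rw [if_pos hflip, decode_apply_of_mem hflip.1 hflip.2, Bool.not_not]
  · rw [if_neg hflip]
    by_cases hB : e ∈ G.edgesAt (G.ball τ a r)
    · exact decode_apply_of_mem_ball hB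
    · exact decode_apply_of_notMem fun he => hflip ⟨he, hB⟩

/-- A ball that stops growing has stopped for good. -/
theorem ball_eq_of_ball_succ_eq {ω : Config E} {a : V} {m : ℕ} (h : G.ball ω a (m + 1) = G.ball ω a m)
    (k : ℕ) : G.ball ω a (m + k) = G.ball ω a m := by
  induction k with
  | zero => rfl
  | succ k ih =>
    rw [← Nat.add_assoc, ball_succ, ih, ← ball_succ, h]

/-- Below the distance, every ball gains a vertex. -/
theorem exists_mem_ball_succ_not_mem_ball {ω : Config E} {a : V} {X : Set V} {r : ℕ}
    (h : G.AtDist ω a X r) {m : ℕ} (hm : m ≤ r) : ∃ v, v ∈ G.ball ω a (m + 1) ∧ v ∉ G.ball ω a m := by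
  by_contra hcon
  push Not at hcon
  have heq : G.ball ω a (m + 1) = G.ball ω a m :=
    Set.Subset.antisymm hcon (ball_subset_succ ω a m)
  obtain ⟨u, hu, huX⟩ := h.2
  have : G.ball ω a (r + 1) = G.ball ω a m := by
    obtain ⟨k, hk⟩ : ∃ k, r + 1 = m + k := ⟨r + 1 - m, by omega⟩
    rw [hk]
    exact ball_eq_of_ball_succ_eq heq k
  rw [this] at hu
  exact h.not_mem_of_mem_ball hm hu huX

/-- **A radius is smaller than the number of vertices**: the balls grow strictly up to the distance, one new
vertex per radius. -/
theorem AtDist.lt_card [Fintype V] {ω : Config E} {a : V} {X : Set V} {r : ℕ}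
    (h : G.AtDist ω a X r) : r < Fintype.card V := by
  choose f hf using fun i : Fin (r + 1) =>
    exists_mem_ball_succ_not_mem_ball h (Nat.lt_succ_iff.mp i.2)
  have hinj : Function.Injective f := by
    intro i j hij
    by_contra hne
    rcases Nat.lt_or_gt_of_ne (fun h => hne (Fin.ext h)) with hlt | hlt
    · have hmem : f i ∈ G.ball ω a j := ball_mono ω a (Nat.succ_le_of_lt hlt) (hf i).1
      rw [hij] at hmem
      exact (hf j).2 hmem
    · have hmem : f j ∈ G.ball ω a i := ball_mono ω a (Nat.succ_le_of_lt hlt) (hf j).1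
      rw [← hij] at hmem
      exact (hf i).2 hmem
  have := Fintype.card_le_of_injective f hinj
  rw [Fintype.card_fin] at this
  omega

/-- A source of `N²` reaches its closed `c`-cluster: every open `a`–`b` walk meets `D`, and one exists. -/
theorem exists_atDist_of_nTwo {ω : Config E} {a b c : V} (h : G.NTwo ω a b c) :
    ∃ r, G.AtDist ω a (G.cluster ωᶜ c) r := by
  obtain ⟨hab, hca, hcb, hav⟩ := h
  -- some vertex of `D` is reached from `a`
  have hreach : ∃ u ∈ G.cluster ωᶜ c, G.Conn ω a u := by
    have key : G.ConnAvoid ω (G.cluster ωᶜ c) a b ∨ ∃ u ∈ G.cluster ωᶜ c, G.Conn ω a u := by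
      refine Conn.induction
        (motive := fun v => G.ConnAvoid ω (G.cluster ωᶜ c) a v ∨ ∃ u ∈ G.cluster ωᶜ c, G.Conn ω a u)
        (Or.inl Relation.ReflTransGen.refl) ?_ hab
      intro x y hax hxy ih
      rcases ih with hx | hx
      · by_cases hyD : G.Conn ωᶜ c y
        · exact Or.inr ⟨y, hyD, hax.tail hxy⟩
        · exact Or.inl (hx.tail ⟨hxy, hx.notMem_of_notMem hca, hyD⟩)
      · exact Or.inr hx
    rcases key with key | key
    · exact absurd key hav
    · exact key
  obtain ⟨u, huD, hau⟩ := hreach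
  obtain ⟨n, hn⟩ := exists_mem_ball_of_conn hau
  classical
  have hex : ∃ n, ∃ u ∈ G.cluster ωᶜ c, u ∈ G.ball ω a n := ⟨n, u, huD, hn⟩
  -- the least radius reaching `D` is positive (`a ∉ D`)
  obtain ⟨m, hm⟩ : ∃ m, Nat.find hex = m + 1 := by
    refine Nat.exists_eq_add_one_of_ne_zero ?_
    intro h0
    obtain ⟨v, hvD, hv⟩ := Nat.find_spec hex
    rw [h0, ball_zero, Set.mem_singleton_iff] at hv
    rw [hv] at hvD
    exact hca hvD
  refine ⟨m, fun v hv hvD => ?_, ?_⟩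
  · exact Nat.find_min hex (by rw [hm]; exact Nat.lt_succ_self m) ⟨v, hvD, hv⟩
  · obtain ⟨v, hvD, hv⟩ := Nat.find_spec hex
    rw [hm] at hv
    exact ⟨v, hv, hvD⟩

open Classical in
/-- **Lemma 28.1, the bijection**: the sources of the class `P` at a finite distance from their closed `c`-cluster
are as many as the valid pairs `(τ, r)` (`r < |V|`): `S ↦ (Z_{r(S)}(S), r(S))`, `(τ, r) ↦ decode_r(τ)`. -/
theorem card_sources_eq_card_validPairs [Fintype V] [Fintype E] (P : Config E → Prop) (c a : V) :
    (univ.filter fun ω : Config E => P ω ∧ ∃ r, G.AtDist ω a (G.cluster ωᶜ c) r).card =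
      ((univ ×ˢ range (Fintype.card V)).filter
        fun p : Config E × ℕ => G.ValidDecoding P c a p.2 p.1).card := by
  refine Finset.card_nbij' (fun ω => (G.ballMap c a ω, G.radius c a ω))
    (fun p => G.decode c a p.2 p.1) ?_ ?_ ?_ ?_
  · intro ω hω
    simp only [Finset.coe_filter, Finset.mem_univ, true_and, Set.mem_setOf_eq, Finset.mem_product,
      Finset.mem_range] at hω ⊢
    obtain ⟨hP, r, hr⟩ := hω
    have hZ : G.ballMap c a ω = G.ballFlip c a r ω := by
      unfold ballMap
      rw [radius_eq hr]
    rw [radius_eq hr, hZ]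
    exact ⟨hr.lt_card, validDecoding_ballFlip hP hr⟩
  · intro p hp
    simp only [Finset.coe_filter, Finset.mem_univ, true_and, Set.mem_setOf_eq, Finset.mem_product,
      Finset.mem_range] at hp ⊢
    refine ⟨hp.2.1, p.2, ?_⟩
    rw [hp.2.2.1]
    exact hp.2.2.2
  · intro ω hω
    simp only [Finset.coe_filter, Finset.mem_univ, true_and, Set.mem_setOf_eq] at hω
    obtain ⟨_, r, hr⟩ := hω
    show G.decode c a (G.radius c a ω) (G.ballMap c a ω) = ω
    unfold ballMap
    rw [radius_eq hr]
    exact decode_ballFlip hr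
  · intro p hp
    simp only [Finset.coe_filter, Finset.mem_univ, true_and, Set.mem_setOf_eq, Finset.mem_product,
      Finset.mem_range] at hp
    have hr : G.AtDist (G.decode c a p.2 p.1) a (G.cluster (G.decode c a p.2 p.1)ᶜ c) p.2 := by
      rw [hp.2.2.1]
      exact hp.2.2.2
    show (G.ballMap c a (G.decode c a p.2 p.1), G.radius c a (G.decode c a p.2 p.1)) = p
    unfold ballMap
    rw [radius_eq hr, ballFlip_decode hp.2]

open Classical in
/-- The valid pairs, counted target by target: `Σ_τ v(τ)` with `v(τ) = #{r < |V| : the r-decoding of τ is valid}`. -/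
theorem card_validPairs_eq_sum [Fintype V] [Fintype E] (P : Config E → Prop) (c a : V) :
    ((univ ×ˢ range (Fintype.card V)).filter
        fun p : Config E × ℕ => G.ValidDecoding P c a p.2 p.1).card =
      ∑ τ : Config E, ((range (Fintype.card V)).filter fun r => G.ValidDecoding P c a r τ).card := by
  rw [Finset.card_filter, Finset.sum_product]
  refine Finset.sum_congr rfl fun τ _ => ?_
  rw [Finset.card_filter]

open Classical in
/-- A target with a valid decoding lies in the cell `ac|b` (for a class `P` with `b ∉ D` and no open `a`–`b`
walk avoiding `D`). -/
theorem mem_cell_of_validDecoding {P : Config E → Prop} {c a b : V}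
    (hP : ∀ ω, P ω → ¬ G.Conn ωᶜ c b ∧ ¬ G.ConnAvoid ω (G.cluster ωᶜ c) a b) {r : ℕ} {τ : Config E}
    (h : G.ValidDecoding P c a r τ) : G.Conn τ c a ∧ ¬ G.Conn τ c b := by
  have hr : G.AtDist (G.decode c a r τ) a (G.cluster (G.decode c a r τ)ᶜ c) r := by
    rw [h.2.1]
    exact h.2.2
  rw [← ballFlip_decode h]
  exact ballFlip_mem_cell hr (hP _ h.1).1 (hP _ h.1).2

open Classical in
/-- **LEMMA 28.1 (mine-3, memo §28)**: `#N² = Σ_{τ ∈ ac|b} v_a(τ)`, `v_a(τ)` = the number of valid `a`-radii of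
`τ` (`r < |V|`); the mirror for `b` is the same statement with the marks exchanged. -/
theorem card_nTwo_eq_sum_validRadii [Fintype V] [Fintype E] (a b c : V) :
    (univ.filter fun ω : Config E => G.NTwo ω a b c).card =
      ∑ τ ∈ (univ.filter fun τ : Config E => G.Conn τ c a ∧ ¬ G.Conn τ c b),
        ((range (Fintype.card V)).filter
          fun r => G.ValidDecoding (fun ω => G.NTwo ω a b c) c a r τ).card := by
  have h1 : (univ.filter fun ω : Config E => G.NTwo ω a b c) =
      (univ.filter fun ω : Config E => G.NTwo ω a b c ∧ ∃ r, G.AtDist ω a (G.cluster ωᶜ c) r) := by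
    ext ω
    simp only [Finset.mem_filter, Finset.mem_univ, true_and]
    exact ⟨fun h => ⟨h, exists_atDist_of_nTwo h⟩, fun h => h.1⟩
  rw [h1, card_sources_eq_card_validPairs, card_validPairs_eq_sum]
  symm
  refine Finset.sum_subset (Finset.filter_subset _ _) ?_
  intro τ _ hτ
  simp only [Finset.mem_filter, Finset.mem_univ, true_and] at hτ
  rw [Finset.card_eq_zero, Finset.filter_eq_empty_iff]
  intro r _ hr
  exact hτ (mem_cell_of_validDecoding (fun _ hω => ⟨hω.2.2.1, hω.2.2.2⟩) hr)

end RadiusCount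

end MultiGraph

end PercRepro
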